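import Literature.AlgebraicGeometry.Motives.MixedHodgeStructureCatDualFunctor
import Literature.AlgebraicGeometry.Motives.MixedHodgeStructureCatWeightQuotients
import HarnessLib

/-!
# Duality exchanges the weight truncations: `(X ∕ W_k X)^∨ ≅ W_{-k-1}(X^∨)` and `X^∨ ∕ W_{-k-1}(X^∨) ≅ (W_k X)^∨`, functorially

Layer `Literature/AlgebraicGeometry/Motives` (lane `lit-hodgefound`), the categorical dictionary of mixed Hodge structures.  The dual mixed Hodge
structure `X^∨` (Cattani–El Zein–Griffiths–Lê, §3.2.2.7: «In particular, the dual `H^*` of a mixed Hodge structure `H` is an MHS»; the tree's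
`MixedHodgeStructure.dual`, `Motives/MixedHodgeStructureDual`) carries the DUAL weight filtration `W_r(X^∨) = (W_{-r-1} X)^⊥` (Deligne, Hodge II,
1.1.6–1.1.7; Fujiki (1.6.2) a): `W'_i = (W_{-i-1})^⊥`; the tree's `MixedHodgeStructure.dual_W`).  Hence duality swaps the two weight truncations
`W_k` (`weightFunctor k`, `weightι k : W_k ⟶ 𝟭`, `Motives/MixedHodgeStructureCatWeightFiltration`) and `X ↦ X ∕ W_k X` (`weightQuotFunctor k`,
`weightπ k : 𝟭 ⟶ (− ∕ W_k)`, `Motives/MixedHodgeStructureCatWeightQuotients`), with the index change `k ↦ -k-1`.  The tree has the unbundled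
statements for an arbitrary sub-MHS `S` (`SubMixedHodgeStructure.annihilator_weight : (W_k H)^⊥ = W_{-k-1}(H^∨)`, `quotientDualHom : (H/S)^∨ ≅ S^⊥`,
`dualQuotientHom : H^∨/S^⊥ ≅ S^∨`, `Motives/MixedHodgeStructureDualSubobjects`); this file states them for the weight truncation FUNCTORS, as
isomorphisms of `MixedHodgeStructureCat` NATURAL in `X`:

* §0 finiteness of `W_k X` and `X ∕ W_k X` for `X` finite-dimensional (needed to form their duals), and `W_{-k-1}(X^∨) = (W_k X)^⊥`;
* §1 **`dualWeightQuotIso k X : (X ∕ W_k X)^∨ ≅ W_{-k-1}(X^∨)`** — the transpose `(X ↠ X ∕ W_k X)^∨ : (X ∕ W_k X)^∨ ⟶ X^∨` co-restricted to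
  `W_{-k-1}(X^∨)` (it lands there because a form on `X ∕ W_k X` kills `W_k X`), bijective (`(q)^∨` is injective, and its image is `(W_k X)^⊥`);
  `dualWeightQuotIso.hom ≫ weightι = (weightπ)^∨`; NATURALITY `(f̄)^∨ ≫ (≅)_X = (≅)_Y ≫ W_{-k-1}(f^∨)` for `f : X ⟶ Y`;
* §2 **`weightQuotDualIso k X : X^∨ ∕ W_{-k-1}(X^∨) ≅ (W_k X)^∨`** — the transpose `(W_k X ↪ X)^∨ : X^∨ ⟶ (W_k X)^∨` (restriction of forms)
  factored through the quotient by its kernel `(W_k X)^⊥ = W_{-k-1}(X^∨)`, bijective; `weightπ ≫ weightQuotDualIso.hom = (weightι)^∨`; NATURALITY;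
* §3 on the full subcategory `FinSubcategory` of finite-dimensional objects, where duality is the functor `dualFunctor : FinSubcategoryᵒᵖ ⥤
  FinSubcategory` (`Motives/MixedHodgeStructureCatDualFunctor`): the lifts `finWeightFunctor k`, `finWeightQuotFunctor k` and the natural
  isomorphisms **`dualWeightQuotNatIso k : (finWeightQuotFunctor k).op ⋙ dualFunctor ≅ dualFunctor ⋙ finWeightFunctor (-k-1)`**
  («`(− ∕ W_k)^∨ = W_{-k-1} ∘ (−)^∨`») and **`weightQuotDualNatIso k : dualFunctor ⋙ finWeightQuotFunctor (-k-1) ≅ (finWeightFunctor k).op ⋙ dualFunctor`**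
  («`(−)^∨ ∕ W_{-k-1} = (W_k −)^∨`»).

Everything is PROVED; no named fact, no instance (finiteness of the truncated objects is recorded as theorems `finite_weightFunctor_obj`,
`finite_weightQuotFunctor_obj` and supplied by `haveI`), no notation.

Sources, verbatim.  E. Cattani, F. El Zein, P. A. Griffiths, Lê D. T. (eds.), *Hodge Theory* (Princeton Math. Notes 49, 2014) [CattaniElZeinGriffithsLe2014],
§3.2.2.7 p. 163 («(2) The MHS `Hom(H, H')` … `W_r Hom(H,H')_ℚ := {f : … : ∀ n, f(W_n H) ⊂ W_{n+2r} H'}` … In particular, the dual `H^*` of a mixed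
Hodge structure `H` is an MHS.»; for `H' = ℚ(0)`, `W_r(H^*) = {f : f(W_{-r-1} H) = 0}`), Lemma 3.2.20 p. 161 (kernels and cokernels of morphisms of
MHS, «The statement on the cokernel follows by duality»), Def. 3.2.15 (`W_k`).  P. Deligne, *Théorie de Hodge II*, Publ. Math. IHÉS 40 (1971)
[DeligneHodgeII1971], 1.1.6–1.1.7 (dual filtration, filtrations on sub- and quotient objects).  A. Fujiki, *Duality of mixed Hodge structures of
algebraic varieties*, Publ. RIMS 16 (1980) [Fujiki1980], (1.6.2) a)–b) (`W'_i := (W_{-i-1})^⊥`; the orthogonal complement of a mixed Hodge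
substructure is a mixed Hodge substructure and the induced pairing is a duality) — through the tree's `Motives/MixedHodgeStructureDualSubobjects`.
The linear algebra (`Submodule.dualAnnihilator`, `Submodule.range_dualMap_mkQ_eq`, `LinearMap.ker_dualMap_eq_dualAnnihilator_range`,
`ObjectProperty.lift`, `NatIso.ofComponents`) is Mathlib's [folklore].

## Main results

* §0 `finite_weightFunctor_obj`, `finite_weightQuotFunctor_obj`, `MixedHodgeStructure.dual_W_neg_sub_one`.
* §1 `transpose_weightπ_apply_mem`, **`dualWeightQuotHom`** (`_comp_weightι_app`, `coe_dualWeightQuotHom_apply`), `dualWeightQuotHom_injective`,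
  `dualWeightQuotHom_surjective`, `dualWeightQuotHom_bijective`, `isIso_dualWeightQuotHom`, **`dualWeightQuotIso`** (`_hom`, `_hom_comp_weightι_app`,
  `_inv_comp_transpose_weightπ`), **`transposeHom_weightQuotFunctor_map_comp_dualWeightQuotHom`** (naturality).
* §2 `ker_transpose_weightι_toLinearMap`, **`weightQuotDualHom`** (`weightπ_app_comp_weightQuotDualHom`, `_apply_mk`), `weightQuotDualHom_injective`,
  `weightQuotDualHom_surjective`, `weightQuotDualHom_bijective`, `isIso_weightQuotDualHom`, **`weightQuotDualIso`** (`_hom`, `weightπ_app_comp_weightQuotDualIso_hom`,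
  `transpose_weightι_comp_weightQuotDualIso_inv`), **`weightQuotFunctor_map_transposeHom_comp_weightQuotDualHom`** (naturality).
* §3 `finWeightFunctor` (`_obj_obj`, `_map_hom`), `finWeightQuotFunctor` (`_obj_obj`, `_map_hom`), **`dualWeightQuotNatIso`** (`_hom_app_hom`),
  **`weightQuotDualNatIso`** (`_hom_app_hom`).

## References

* [CattaniElZeinGriffithsLe2014] E. Cattani et al. (eds.), Hodge Theory, Princeton Math. Notes 49 (2014), §3.2.2.7, Lemma 3.2.20, Def. 3.2.15.
* [DeligneHodgeII1971] P. Deligne, Théorie de Hodge II, Publ. Math. IHÉS 40 (1971), 1.1.6–1.1.7.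
* [Fujiki1980] A. Fujiki, Duality of mixed Hodge structures of algebraic varieties, Publ. RIMS Kyoto Univ. 16 (1980), (1.6.2) a)–b).

## Provenance

Lane `lit-hodgefound` (summit `HodgeConjecture`), seat `lit-hodgefound-p36` (literature-prover, generation 47, row g47-#8).
-/

noncomputable section

open CategoryTheory Opposite

namespace Literature.AlgebraicGeometry.Motives

universe u

/-! ## §0 Finiteness of the truncations; `W_{-k-1}(X^∨) = (W_k X)^⊥` -/

namespace MixedHodgeStructure

/-- `W_{-k-1}(V^∨) = (W_k V)^⊥` (the dual weight filtration `W_r(V^∨) = (W_{-r-1} V)^⊥` at `r = -k-1`).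
[cite: DeligneHodgeII1971, 1.1.6–1.1.7] [cite: Fujiki1980, (1.6.2) a)] -/
theorem dual_W_neg_sub_one {V : Type u} [AddCommGroup V] [Module ℚ V] [FiniteDimensional ℚ V] (H : MixedHodgeStructure V) (k : ℤ) :
    H.dual.W (-k - 1) = (H.W k).dualAnnihilator := by
  rw [dual_W, show -(-k - 1) - 1 = k by ring]

end MixedHodgeStructure

namespace MixedHodgeStructureCat

open MixedHodgeStructure (SubMixedHodgeStructure)

variable (k : ℤ)

section Ambient

variable {X Y : MixedHodgeStructureCat.{u}} [Module.Finite ℚ X] [Module.Finite ℚ Y]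

variable (X) in
/-- `W_k X` is finite-dimensional when `X` is. [cite: CattaniElZeinGriffithsLe2014, Def. 3.2.15] -/
theorem finite_weightFunctor_obj : Module.Finite ℚ ((weightFunctor k).obj X) :=
  inferInstanceAs (Module.Finite ℚ ↥(X.str.W k))

variable (X) in
/-- `X ∕ W_k X` is finite-dimensional when `X` is. [cite: CattaniElZeinGriffithsLe2014, Lemma 3.2.20] -/
theorem finite_weightQuotFunctor_obj : Module.Finite ℚ ((weightQuotFunctor k).obj X) :=
  inferInstanceAs (Module.Finite ℚ ((X : Type u) ⧸ X.str.W k))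

/-! ## §1 `(X ∕ W_k X)^∨ ≅ W_{-k-1}(X^∨)` -/

variable (X) in
/-- A form on `X ∕ W_k X`, pulled back to `X` along `X ↠ X ∕ W_k X`, kills `W_k X`: the transpose `(X ↠ X ∕ W_k X)^∨` lands in
`W_{-k-1}(X^∨) = (W_k X)^⊥`. [cite: Fujiki1980, (1.6.2) a)–b)] [cite: CattaniElZeinGriffithsLe2014, §3.2.2.7] -/
theorem transpose_weightπ_apply_mem (φ : Module.Dual ℚ ((X : Type u) ⧸ X.str.W k)) :
    (SubMixedHodgeStructure.weight X.str k).mkQ.transpose.toLinearMap φ ∈ X.str.dual.W (-k - 1) := by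
  rw [MixedHodgeStructure.dual_W_neg_sub_one, Submodule.mem_dualAnnihilator]
  intro w hw
  change φ (Submodule.Quotient.mk w) = 0
  rw [(Submodule.Quotient.mk_eq_zero _).2 hw, map_zero]

variable (X) in
/-- **The comparison morphism `(X ∕ W_k X)^∨ ⟶ W_{-k-1}(X^∨)`**: the transpose of the projection `X ↠ X ∕ W_k X`, co-restricted to the sub-MHS
`W_{-k-1}(X^∨)` of `X^∨` (a morphism of MHS by the universal property of sub-MHS, `SubMixedHodgeStructure.codRestrict`).
[cite: Fujiki1980, (1.6.2) b)] [cite: CattaniElZeinGriffithsLe2014, §3.2.2.7 and Lemma 3.2.20] -/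
def dualWeightQuotHom :
    of (SubMixedHodgeStructure.weight X.str k).quotient.dual ⟶ (weightFunctor (-k - 1)).obj (of X.str.dual) :=
  (SubMixedHodgeStructure.weight X.str.dual (-k - 1)).codRestrict (SubMixedHodgeStructure.weight X.str k).mkQ.transpose
    (transpose_weightπ_apply_mem k X)

/-- `dualWeightQuotHom ≫ (W_{-k-1}(X^∨) ↪ X^∨) = (X ↠ X ∕ W_k X)^∨`. [cite: Fujiki1980, (1.6.2) b)] -/
theorem dualWeightQuotHom_comp_weightι_app :
    dualWeightQuotHom k X ≫ (weightι (-k - 1)).app (of X.str.dual) = (SubMixedHodgeStructure.weight X.str k).mkQ.transpose :=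
  SubMixedHodgeStructure.subtype_comp_codRestrict _ _ _

/-- The same, with the projection written as the component `(weightπ k).app X` of the categorical dictionary and the transpose as `transposeHom`.
[cite: Fujiki1980, (1.6.2) b)] -/
theorem dualWeightQuotHom_comp_weightι_app' :
    haveI := finite_weightQuotFunctor_obj k X
    dualWeightQuotHom k X ≫ (weightι (-k - 1)).app (of X.str.dual) =
      transposeHom (X := X) (Y := (weightQuotFunctor k).obj X) ((weightπ k).app X) :=
  dualWeightQuotHom_comp_weightι_app k

/-- On vectors: `dualWeightQuotHom φ = φ ∘ (X ↠ X ∕ W_k X)`. [cite: Fujiki1980, (1.6.2) b)] -/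
@[simp]
theorem coe_dualWeightQuotHom_apply (φ : Module.Dual ℚ ((X : Type u) ⧸ X.str.W k)) :
    Subtype.val ((dualWeightQuotHom k X).toLinearMap φ) = φ ∘ₗ (X.str.W k).mkQ :=
  rfl

/-- `dualWeightQuotHom` is injective (`q^∨` is injective for `q` surjective). [cite: Fujiki1980, (1.6.2) b)] -/
theorem dualWeightQuotHom_injective : Function.Injective (dualWeightQuotHom k X).toLinearMap := fun _ _ h =>
  LinearMap.dualMap_injective_of_surjective (Submodule.mkQ_surjective (X.str.W k)) (congrArg Subtype.val h)

/-- `dualWeightQuotHom` is surjective: `W_{-k-1}(X^∨) = (W_k X)^⊥` is the image of `(X ↠ X ∕ W_k X)^∨` (`Submodule.range_dualMap_mkQ_eq`).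
[cite: Fujiki1980, (1.6.2) b)] -/
theorem dualWeightQuotHom_surjective : Function.Surjective (dualWeightQuotHom k X).toLinearMap := by
  rintro ⟨ψ, hψ⟩
  have hψ' : ψ ∈ LinearMap.range (X.str.W k).mkQ.dualMap := by
    rw [Submodule.range_dualMap_mkQ_eq, ← MixedHodgeStructure.dual_W_neg_sub_one]
    exact hψ
  obtain ⟨φ, hφ⟩ := hψ'
  exact ⟨φ, Subtype.ext hφ⟩

/-- `dualWeightQuotHom` is bijective. [cite: Fujiki1980, (1.6.2) b)] -/
theorem dualWeightQuotHom_bijective : Function.Bijective (dualWeightQuotHom k X).toLinearMap :=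
  ⟨dualWeightQuotHom_injective k, dualWeightQuotHom_surjective k⟩

/-- `dualWeightQuotHom` is an isomorphism of MHS (bijective morphisms of MHS are isomorphisms, Thm. 3.2.18). [cite: Fujiki1980, (1.6.2) b)]
[cite: CattaniElZeinGriffithsLe2014, Thm. 3.2.18] -/
theorem isIso_dualWeightQuotHom : IsIso (dualWeightQuotHom k X) :=
  isIso_of_bijective _ (dualWeightQuotHom_bijective k)

variable (X) in
/-- **`(X ∕ W_k X)^∨ ≅ W_{-k-1}(X^∨)`** in `MixedHodgeStructureCat` — duality turns the quotient truncation into the sub-truncation of the dual.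
[cite: Fujiki1980, (1.6.2) a)–b)] [cite: CattaniElZeinGriffithsLe2014, §3.2.2.7] [cite: DeligneHodgeII1971, 1.1.6–1.1.7] -/
def dualWeightQuotIso :
    of (SubMixedHodgeStructure.weight X.str k).quotient.dual ≅ (weightFunctor (-k - 1)).obj (of X.str.dual) :=
  @asIso _ _ _ _ (dualWeightQuotHom k X) (isIso_dualWeightQuotHom k)

/-- Unfolding `dualWeightQuotIso` (hom). [cite: Fujiki1980, (1.6.2) b)] -/
theorem dualWeightQuotIso_hom : (dualWeightQuotIso k X).hom = dualWeightQuotHom k X := rfl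

/-- `(≅) ≫ (W_{-k-1}(X^∨) ↪ X^∨) = (X ↠ X ∕ W_k X)^∨`. [cite: Fujiki1980, (1.6.2) b)] -/
theorem dualWeightQuotIso_hom_comp_weightι_app :
    (dualWeightQuotIso k X).hom ≫ (weightι (-k - 1)).app (of X.str.dual) = (SubMixedHodgeStructure.weight X.str k).mkQ.transpose :=
  dualWeightQuotHom_comp_weightι_app k

/-- `(≅)⁻¹ ≫ (X ↠ X ∕ W_k X)^∨ = (W_{-k-1}(X^∨) ↪ X^∨)`. [cite: Fujiki1980, (1.6.2) b)] -/
theorem dualWeightQuotIso_inv_comp_transpose_weightπ :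
    (dualWeightQuotIso k X).inv ≫ (SubMixedHodgeStructure.weight X.str k).mkQ.transpose = (weightι (-k - 1)).app (of X.str.dual) :=
  (Iso.inv_comp_eq _).2 (dualWeightQuotIso_hom_comp_weightι_app k).symm

/-- **Naturality of `(X ∕ W_k X)^∨ ≅ W_{-k-1}(X^∨)`**: for `f : X ⟶ Y`, with `f̄ : X ∕ W_k X ⟶ Y ∕ W_k Y` the induced morphism,
`(f̄)^∨ ≫ (≅)_X = (≅)_Y ≫ W_{-k-1}(f^∨)` (both are `φ ↦ φ ∘ q_Y ∘ f = φ ∘ f̄ ∘ q_X`). [cite: Fujiki1980, (1.6.2) b)]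
[cite: CattaniElZeinGriffithsLe2014, Lemma 3.2.20 and §3.2.2.7] -/
theorem transposeHom_weightQuotFunctor_map_comp_dualWeightQuotHom (f : X ⟶ Y) :
    haveI := finite_weightQuotFunctor_obj k X
    haveI := finite_weightQuotFunctor_obj k Y
    transposeHom ((weightQuotFunctor k).map f) ≫ dualWeightQuotHom k X =
      dualWeightQuotHom k Y ≫ (weightFunctor (-k - 1)).map (transposeHom f) := by
  rw [← cancel_mono ((weightι (-k - 1)).app (of X.str.dual))]
  exact hom_ext (LinearMap.ext fun φ => LinearMap.ext fun x => rfl)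

/-! ## §2 `X^∨ ∕ W_{-k-1}(X^∨) ≅ (W_k X)^∨` -/

variable (X) in
/-- The kernel of the restriction `(W_k X ↪ X)^∨ : X^∨ ⟶ (W_k X)^∨` is `(W_k X)^⊥ = W_{-k-1}(X^∨)`. [cite: Fujiki1980, (1.6.2) a)–b)] -/
theorem ker_transpose_weightι_toLinearMap :
    LinearMap.ker (SubMixedHodgeStructure.weight X.str k).subtype.transpose.toLinearMap = X.str.dual.W (-k - 1) := by
  change LinearMap.ker (X.str.W k).subtype.dualMap = _
  rw [LinearMap.ker_dualMap_eq_dualAnnihilator_range, Submodule.range_subtype, MixedHodgeStructure.dual_W_neg_sub_one]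

variable (X) in
/-- **The comparison morphism `X^∨ ∕ W_{-k-1}(X^∨) ⟶ (W_k X)^∨`**: the restriction of forms `(W_k X ↪ X)^∨ : X^∨ ⟶ (W_k X)^∨`, factored through
the quotient of `X^∨` by its kernel `W_{-k-1}(X^∨)` (a morphism of MHS by the universal property of quotient MHS, `SubMixedHodgeStructure.quotientLift`).
[cite: Fujiki1980, (1.6.2) b)] [cite: CattaniElZeinGriffithsLe2014, §3.2.2.7 and Lemma 3.2.20] -/
def weightQuotDualHom :
    (weightQuotFunctor (-k - 1)).obj (of X.str.dual) ⟶ of (SubMixedHodgeStructure.weight X.str k).toMixedHodgeStructure.dual :=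
  (SubMixedHodgeStructure.weight X.str.dual (-k - 1)).quotientLift (SubMixedHodgeStructure.weight X.str k).subtype.transpose
    (ker_transpose_weightι_toLinearMap k X).ge

/-- `(X^∨ ↠ X^∨ ∕ W_{-k-1}) ≫ weightQuotDualHom = (W_k X ↪ X)^∨`. [cite: Fujiki1980, (1.6.2) b)] -/
theorem weightπ_app_comp_weightQuotDualHom :
    (weightπ (-k - 1)).app (of X.str.dual) ≫ weightQuotDualHom k X = (SubMixedHodgeStructure.weight X.str k).subtype.transpose :=
  SubMixedHodgeStructure.quotientLift_comp_mkQ _ _ _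

/-- The same, with the inclusion written as the component `(weightι k).app X` and the transpose as `transposeHom`. [cite: Fujiki1980, (1.6.2) b)] -/
theorem weightπ_app_comp_weightQuotDualHom' :
    haveI := finite_weightFunctor_obj k X
    (weightπ (-k - 1)).app (of X.str.dual) ≫ weightQuotDualHom k X =
      transposeHom (X := (weightFunctor k).obj X) (Y := X) ((weightι k).app X) :=
  weightπ_app_comp_weightQuotDualHom k

/-- On vectors: `weightQuotDualHom [φ] = φ|_{W_k X}`. [cite: Fujiki1980, (1.6.2) b)] -/
@[simp]
theorem weightQuotDualHom_apply_mk (φ : Module.Dual ℚ X) :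
    (weightQuotDualHom k X).toLinearMap (Submodule.Quotient.mk φ) = φ ∘ₗ (X.str.W k).subtype :=
  rfl

/-- `weightQuotDualHom` is injective (its kernel `W_{-k-1}(X^∨) ∕ W_{-k-1}(X^∨)` is zero). [cite: Fujiki1980, (1.6.2) b)] -/
theorem weightQuotDualHom_injective : Function.Injective (weightQuotDualHom k X).toLinearMap :=
  LinearMap.ker_eq_bot.1 (Submodule.ker_liftQ_eq_bot' _ _ (ker_transpose_weightι_toLinearMap k X).symm)

/-- `weightQuotDualHom` is surjective (restriction of forms to a subspace is onto). [cite: Fujiki1980, (1.6.2) b)] -/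
theorem weightQuotDualHom_surjective : Function.Surjective (weightQuotDualHom k X).toLinearMap :=
  LinearMap.range_eq_top.1 ((Submodule.range_liftQ _ _ _).trans
    (LinearMap.range_eq_top.2 (LinearMap.dualMap_surjective_of_injective (X.str.W k).injective_subtype)))

/-- `weightQuotDualHom` is bijective. [cite: Fujiki1980, (1.6.2) b)] -/
theorem weightQuotDualHom_bijective : Function.Bijective (weightQuotDualHom k X).toLinearMap :=
  ⟨weightQuotDualHom_injective k, weightQuotDualHom_surjective k⟩

/-- `weightQuotDualHom` is an isomorphism of MHS. [cite: Fujiki1980, (1.6.2) b)] [cite: CattaniElZeinGriffithsLe2014, Thm. 3.2.18] -/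
theorem isIso_weightQuotDualHom : IsIso (weightQuotDualHom k X) :=
  isIso_of_bijective _ (weightQuotDualHom_bijective k)

variable (X) in
/-- **`X^∨ ∕ W_{-k-1}(X^∨) ≅ (W_k X)^∨`** in `MixedHodgeStructureCat` — duality turns the sub-truncation into the quotient truncation of the dual.
[cite: Fujiki1980, (1.6.2) a)–b)] [cite: CattaniElZeinGriffithsLe2014, §3.2.2.7] [cite: DeligneHodgeII1971, 1.1.6–1.1.7] -/
def weightQuotDualIso :
    (weightQuotFunctor (-k - 1)).obj (of X.str.dual) ≅ of (SubMixedHodgeStructure.weight X.str k).toMixedHodgeStructure.dual :=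
  @asIso _ _ _ _ (weightQuotDualHom k X) (isIso_weightQuotDualHom k)

/-- Unfolding `weightQuotDualIso` (hom). [cite: Fujiki1980, (1.6.2) b)] -/
theorem weightQuotDualIso_hom : (weightQuotDualIso k X).hom = weightQuotDualHom k X := rfl

/-- `(X^∨ ↠ X^∨ ∕ W_{-k-1}) ≫ (≅) = (W_k X ↪ X)^∨`. [cite: Fujiki1980, (1.6.2) b)] -/
theorem weightπ_app_comp_weightQuotDualIso_hom :
    (weightπ (-k - 1)).app (of X.str.dual) ≫ (weightQuotDualIso k X).hom = (SubMixedHodgeStructure.weight X.str k).subtype.transpose :=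
  weightπ_app_comp_weightQuotDualHom k

/-- `(W_k X ↪ X)^∨ ≫ (≅)⁻¹ = (X^∨ ↠ X^∨ ∕ W_{-k-1})`. [cite: Fujiki1980, (1.6.2) b)] -/
theorem transpose_weightι_comp_weightQuotDualIso_inv :
    (SubMixedHodgeStructure.weight X.str k).subtype.transpose ≫ (weightQuotDualIso k X).inv = (weightπ (-k - 1)).app (of X.str.dual) :=
  (Iso.comp_inv_eq _).2 (weightπ_app_comp_weightQuotDualIso_hom k).symm

/-- **Naturality of `X^∨ ∕ W_{-k-1}(X^∨) ≅ (W_k X)^∨`**: for `f : X ⟶ Y`, `(f^∨ mod W_{-k-1}) ≫ (≅)_X = (≅)_Y ≫ (W_k f)^∨`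
(both are `[ψ] ↦ ψ ∘ f|_{W_k X}`). [cite: Fujiki1980, (1.6.2) b)] [cite: CattaniElZeinGriffithsLe2014, Lemma 3.2.20 and §3.2.2.7] -/
theorem weightQuotFunctor_map_transposeHom_comp_weightQuotDualHom (f : X ⟶ Y) :
    haveI := finite_weightFunctor_obj k X
    haveI := finite_weightFunctor_obj k Y
    (weightQuotFunctor (-k - 1)).map (transposeHom f) ≫ weightQuotDualHom k X =
      weightQuotDualHom k Y ≫ transposeHom ((weightFunctor k).map f) := by
  rw [← cancel_epi ((weightπ (-k - 1)).app (of Y.str.dual))]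
  exact hom_ext (LinearMap.ext fun ψ => LinearMap.ext fun x => rfl)

end Ambient

/-! ## §3 On `FinSubcategory`: `(− ∕ W_k)^∨ ≅ W_{-k-1} ∘ (−)^∨` and `(−)^∨ ∕ W_{-k-1} ≅ (W_k −)^∨` as natural isomorphisms -/

section Fin

/-- **`W_k` on the finite-dimensional full subcategory** (lift of `weightFunctor k`; `W_k X` is finite-dimensional with `X`).
[cite: CattaniElZeinGriffithsLe2014, Def. 3.2.15 and Lemma 3.2.20] -/
def finWeightFunctor : FinSubcategory.{u} ⥤ FinSubcategory.{u} :=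
  isFinite.lift (isFinite.ι ⋙ weightFunctor k) fun X =>
    haveI : Module.Finite ℚ X.obj := X.property
    finite_weightFunctor_obj k X.obj

/-- Unfolding `finWeightFunctor` on objects. [cite: CattaniElZeinGriffithsLe2014, Def. 3.2.15] -/
theorem finWeightFunctor_obj_obj (X : FinSubcategory.{u}) : ((finWeightFunctor k).obj X).obj = (weightFunctor k).obj X.obj := rfl

/-- Unfolding `finWeightFunctor` on morphisms. [cite: CattaniElZeinGriffithsLe2014, Lemma 3.2.20] -/
theorem finWeightFunctor_map_hom {X Y : FinSubcategory.{u}} (f : X ⟶ Y) :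
    ((finWeightFunctor k).map f).hom = (weightFunctor k).map f.hom := rfl

/-- **`X ↦ X ∕ W_k X` on the finite-dimensional full subcategory** (lift of `weightQuotFunctor k`).
[cite: CattaniElZeinGriffithsLe2014, Lemma 3.2.20] -/
def finWeightQuotFunctor : FinSubcategory.{u} ⥤ FinSubcategory.{u} :=
  isFinite.lift (isFinite.ι ⋙ weightQuotFunctor k) fun X =>
    haveI : Module.Finite ℚ X.obj := X.property
    finite_weightQuotFunctor_obj k X.obj

/-- Unfolding `finWeightQuotFunctor` on objects. [cite: CattaniElZeinGriffithsLe2014, Lemma 3.2.20] -/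
theorem finWeightQuotFunctor_obj_obj (X : FinSubcategory.{u}) :
    ((finWeightQuotFunctor k).obj X).obj = (weightQuotFunctor k).obj X.obj := rfl

/-- Unfolding `finWeightQuotFunctor` on morphisms. [cite: CattaniElZeinGriffithsLe2014, Lemma 3.2.20] -/
theorem finWeightQuotFunctor_map_hom {X Y : FinSubcategory.{u}} (f : X ⟶ Y) :
    ((finWeightQuotFunctor k).map f).hom = (weightQuotFunctor k).map f.hom := rfl

/-- **`(− ∕ W_k)^∨ ≅ W_{-k-1} ∘ (−)^∨`** as functors `FinSubcategoryᵒᵖ ⥤ FinSubcategory` (components `dualWeightQuotIso`).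
[cite: Fujiki1980, (1.6.2) a)–b)] [cite: CattaniElZeinGriffithsLe2014, §3.2.2.7] [cite: DeligneHodgeII1971, 1.1.6–1.1.7] -/
def dualWeightQuotNatIso : (finWeightQuotFunctor.{u} k).op ⋙ dualFunctor ≅ dualFunctor ⋙ finWeightFunctor (-k - 1) :=
  NatIso.ofComponents
    (fun X =>
      haveI : Module.Finite ℚ X.unop.obj := X.unop.property
      isFinite.isoMk (dualWeightQuotIso k X.unop.obj))
    (fun {X Y} f => by
      apply isFinite.hom_ext
      haveI : Module.Finite ℚ X.unop.obj := X.unop.property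
      haveI : Module.Finite ℚ Y.unop.obj := Y.unop.property
      exact transposeHom_weightQuotFunctor_map_comp_dualWeightQuotHom k f.unop.hom)

/-- Components of `dualWeightQuotNatIso`. [cite: Fujiki1980, (1.6.2) b)] -/
theorem dualWeightQuotNatIso_hom_app_hom (X : FinSubcategory.{u}ᵒᵖ) :
    ((dualWeightQuotNatIso k).hom.app X).hom =
      (haveI : Module.Finite ℚ X.unop.obj := X.unop.property; dualWeightQuotHom k X.unop.obj) := rfl

/-- **`(−)^∨ ∕ W_{-k-1} ≅ (W_k −)^∨`** as functors `FinSubcategoryᵒᵖ ⥤ FinSubcategory` (components `weightQuotDualIso`).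
[cite: Fujiki1980, (1.6.2) a)–b)] [cite: CattaniElZeinGriffithsLe2014, §3.2.2.7] [cite: DeligneHodgeII1971, 1.1.6–1.1.7] -/
def weightQuotDualNatIso : dualFunctor ⋙ finWeightQuotFunctor.{u} (-k - 1) ≅ (finWeightFunctor k).op ⋙ dualFunctor :=
  NatIso.ofComponents
    (fun X =>
      haveI : Module.Finite ℚ X.unop.obj := X.unop.property
      isFinite.isoMk (weightQuotDualIso k X.unop.obj))
    (fun {X Y} f => by
      apply isFinite.hom_ext
      haveI : Module.Finite ℚ X.unop.obj := X.unop.property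
      haveI : Module.Finite ℚ Y.unop.obj := Y.unop.property
      exact weightQuotFunctor_map_transposeHom_comp_weightQuotDualHom k f.unop.hom)

/-- Components of `weightQuotDualNatIso`. [cite: Fujiki1980, (1.6.2) b)] -/
theorem weightQuotDualNatIso_hom_app_hom (X : FinSubcategory.{u}ᵒᵖ) :
    ((weightQuotDualNatIso k).hom.app X).hom =
      (haveI : Module.Finite ℚ X.unop.obj := X.unop.property; weightQuotDualHom k X.unop.obj) := rfl

end Fin

end MixedHodgeStructureCat

end Literature.AlgebraicGeometry.Motives
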